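import Mathlib
import Literature.Analysis.ValidatedNumerics.ConeColumnPathDerivatives
import HarnessLib

/-!
# The cone-algebra Dirichlet inverse inverts the Laplacian on the open unit disk

Topic `Literature/Analysis/ValidatedNumerics`.  Completion of the Dirichlet semantics of the operator
`Δ_D⁻¹ = ConeSemilinear.dirInv` of the certnum F2 (B″)/(B-SL) certificates: after the boundary statement
`(Δ_D⁻¹u)(ζ) = 0` on `|ζ| = 1` (`ConeDirichletInverseSemantics.lean`), this file proves the INTERIOR one —
for `ϱ > 1`, every `u` in the cone Wiener algebra `W = ℓ¹_ϱ(ζ^aζ̄^b)` and every `z` with `|z| < 1`,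

  **`Δ (Δ_D⁻¹u)(z) = u(z)`**   (`lapRI_eval_dirInv`),

with `Δ = ConeMonomial.lapRI` (sum of the two second directional derivatives along `1` and `I`, the
form used in `ConeMonomialLaplacian.lean`) applied to the represented function `w ↦ (Δ_D⁻¹u)(w) = eval …`.
Proof: the column representation `(Δ_D⁻¹u)(z+tc) = Σ_m u_m w_m(z+tc)` (each `w_m` a two-term polynomial),
termwise differentiation twice along the real parameter `t` on a small interval
(`hasDerivAt_tsum_of_isPreconnected`; first derivatives of the column paths are bounded by `|u_m|`,
second ones by `(|m|+2)|u_m|`, summable because `ϱ > 1`), and the column identity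
`∂²_t w_m(z+t)|₀ + ∂²_t w_m(z+tI)|₀ = ζ^aζ̄^b` (= `ConeMonomial.lapRI_monomial`, re-derived for the explicit
derivative formulas).  Together with `ConeEval.evalAlgHom` (pointwise products) this says: a zero
`x ∈ W` of the (B-SL) map `x − Δ_D⁻¹(v x + Σ c_k x^k) − g` represents a function with
`Δx = v·x + Σ c_k x^k + Δg`-type interior equation `Δ(x − g)(z) = (v x + Σ c_k x^k)(z)` on the open disk
(`lapRI_sub_eq_of_semilinMap_eq_zero`) and `x = g` on the circle (previous file).

## Sources

[ArioliKoch2019] §2 (2.7)–(2.10), Lemma 2.1 (termwise Dirichlet inverse of `Δ = 4∂_z∂_z̄` on the disk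
algebra), §3 Lemma 3.1 ("If `ρ > 1` then the functions in `A_ρ` extend analytically to some complex open
neighborhood of `Ω`" — the regularity that makes termwise differentiation legitimate), eq. (1.4) (p. 4) and §4 Lemma 4.1 (pp. 9–10).

## What is NOT covered

`C²`-regularity in the Fréchet sense / equality with Mathlib's `Δ` (that bridge is
`ConformalLaplacian.lapRI_eq_laplacian` for `C²` functions; here only the directional form is computed);
analytic extension; float model.

## Provenance

AI-produced formalisation (cell certnum, seat certnum-ode-2, 2026-08-27).
-/

set_option autoImplicit false

open scoped BigOperators Topology
open Complex Filter Set

noncomputable section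

namespace Literature.Analysis.ValidatedNumerics

namespace ConeEval

open WeightedSeq WienerAlgebra ConeMonomial ConeSemilinear

variable {ϱ : ℝ}

/-! ### §4. Termwise differentiation of the column representation -/

/-- `f'' = (f')'`. [folklore] -/
private theorem iteratedDeriv_two (f : ℝ → ℂ) : iteratedDeriv 2 f = deriv (deriv f) := by
  rw [iteratedDeriv_eq_iterate]
  rfl

/-- `Σ |u_m| < ∞` (the weight is `≥ 1`). [cite: ArioliKoch2019, §3 eq. (3.2)] -/
theorem summable_abs_cf (hϱ : 1 ≤ ϱ) (u : Wiener (coneSubmultWeight hϱ)) : Summable fun m => |cf u m| := by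
  refine Summable.of_nonneg_of_le (fun _ => abs_nonneg _) (fun m => ?_) (mem_cf u)
  have hw : 1 ≤ (coneSubmultWeight hϱ).toFun m := by rw [coneSubmultWeight_apply]; exact one_le_pow₀ hϱ
  have := abs_nonneg (cf u m)
  nlinarith

/-- On the parameter interval `|t| < 1 − |z|` the line `z + tc` (`|c| ≤ 1`) stays in the closed disk.
[folklore] -/
private theorem norm_line_le_one {z c : ℂ} (hc : ‖c‖ ≤ 1) {t : ℝ} (ht : t ∈ Ioo (-(1 - ‖z‖)) (1 - ‖z‖)) :
    ‖z + (t : ℂ) * c‖ ≤ 1 := by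
  have habs : |t| < 1 - ‖z‖ := abs_lt.2 ⟨ht.1, ht.2⟩
  calc ‖z + (t : ℂ) * c‖ ≤ ‖z‖ + ‖(t : ℂ) * c‖ := norm_add_le _ _
    _ ≤ ‖z‖ + |t| * 1 := by
        rw [norm_mul, Complex.norm_real, Real.norm_eq_abs]
        exact add_le_add le_rfl (mul_le_mul_of_nonneg_left hc (abs_nonneg _))
    _ ≤ 1 := by linarith

/-- The column series along a line: `G(t) = Σ_m u_m w_m(z + tc)`.
[cite: ArioliKoch2019, §2 Lemma 2.1 with §3 Prop. 3.2] -/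
def colSeries (hϱ : 1 ≤ ϱ) (u : Wiener (coneSubmultWeight hϱ)) (z c : ℂ) (t : ℝ) : ℂ :=
  ∑' m, (cf u m : ℂ) * colPath m z c t

/-- Its termwise first derivative `Σ_m u_m ∂_t w_m(z + tc)`. [cite: ArioliKoch2019, §2 Lemma 2.1] -/
def colSeriesD1 (hϱ : 1 ≤ ϱ) (u : Wiener (coneSubmultWeight hϱ)) (z c : ℂ) (t : ℝ) : ℂ :=
  ∑' m, (cf u m : ℂ) * colPathD1 m z c t

/-- Its termwise second derivative `Σ_m u_m ∂²_t w_m(z + tc)`. [cite: ArioliKoch2019, §2 Lemma 2.1] -/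
def colSeriesD2 (hϱ : 1 ≤ ϱ) (u : Wiener (coneSubmultWeight hϱ)) (z c : ℂ) (t : ℝ) : ℂ :=
  ∑' m, (cf u m : ℂ) * colPathD2 m z c t

/-- **First termwise derivative** on the interval `|t| < 1 − |z|` (bound `|u_m|·1`, summable for `ϱ ≥ 1`).
[cite: ArioliKoch2019, §3 Lemma 3.1 (regularity of A_ρ functions)] -/
theorem hasDerivAt_colSeries (hϱ : 1 ≤ ϱ) (u : Wiener (coneSubmultWeight hϱ)) {z c : ℂ} (hz : ‖z‖ < 1)
    (hc : ‖c‖ ≤ 1) {t : ℝ} (ht : t ∈ Ioo (-(1 - ‖z‖)) (1 - ‖z‖)) :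
    HasDerivAt (colSeries hϱ u z c) (colSeriesD1 hϱ u z c t) t := by
  have h0 : (0 : ℝ) ∈ Ioo (-(1 - ‖z‖)) (1 - ‖z‖) := by constructor <;> linarith
  unfold colSeries colSeriesD1
  refine hasDerivAt_tsum_of_isPreconnected (u := fun m => |cf u m| * 1) (summable_abs_cf hϱ u |>.mul_right 1)
    isOpen_Ioo isPreconnected_Ioo (fun m y _ => (hasDerivAt_colPath m z c y).const_mul _)
    (fun m y hy => ?_) h0 ?_ ht
  · rw [norm_mul, Complex.norm_real, Real.norm_eq_abs]
    exact mul_le_mul_of_nonneg_left (norm_colPathD1_le m (norm_line_le_one hc hy) hc) (abs_nonneg _)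
  · refine Summable.of_norm_bounded ((summable_abs_cf hϱ u).mul_right (1 / 2)) fun m => ?_
    rw [norm_mul, Complex.norm_real, Real.norm_eq_abs]
    exact mul_le_mul_of_nonneg_left (norm_colPath_le m (norm_line_le_one hc h0)) (abs_nonneg _)

/-- **Second termwise derivative** on the interval `|t| < 1 − |z|` (bound `(a+b+2)|u_m| ≤ C ϱ^{a+b}|u_m|`,
summable because `ϱ > 1`). [cite: ArioliKoch2019, §3 Lemma 3.1 (ρ > 1)] -/
theorem hasDerivAt_colSeriesD1 (hϱ1 : 1 < ϱ) (u : Wiener (coneSubmultWeight hϱ1.le)) {z c : ℂ}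
    (hz : ‖z‖ < 1) (hc : ‖c‖ ≤ 1) {t : ℝ} (ht : t ∈ Ioo (-(1 - ‖z‖)) (1 - ‖z‖)) :
    HasDerivAt (colSeriesD1 hϱ1.le u z c) (colSeriesD2 hϱ1.le u z c t) t := by
  have hϱ : 1 ≤ ϱ := hϱ1.le
  have h0 : (0 : ℝ) ∈ Ioo (-(1 - ‖z‖)) (1 - ‖z‖) := by constructor <;> linarith
  set C : ℝ := 1 / (ϱ - 1) + 2 with hC
  have hC0 : 0 ≤ C := by rw [hC]; have := sub_pos.2 hϱ1; positivity
  -- the dominating family `C · |u_m| ω(m)`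
  have hdom : Summable fun m => C * (|cf u m| * (coneSubmultWeight hϱ).toFun m) :=
    (mem_cf u).mul_left C
  unfold colSeriesD1 colSeriesD2
  refine hasDerivAt_tsum_of_isPreconnected hdom isOpen_Ioo isPreconnected_Ioo
    (fun m y _ => (hasDerivAt_colPathD1 m z c y).const_mul _) (fun m y hy => ?_) h0 ?_ ht
  · rw [norm_mul, Complex.norm_real, Real.norm_eq_abs]
    have hb := norm_colPathD2_le m (norm_line_le_one hc hy) hc
    have hg : ((idx m).1 : ℝ) + (idx m).2 + 2 ≤ C * (coneSubmultWeight hϱ).toFun m := by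
      rw [coneSubmultWeight_apply, idx_apply]
      have := deg_add_two_le_weight hϱ1 (m 0 + m 1)
      push_cast at this
      simpa [hC] using this
    calc |cf u m| * ‖colPathD2 m z c y‖ ≤ |cf u m| * (C * (coneSubmultWeight hϱ).toFun m) :=
          mul_le_mul_of_nonneg_left (hb.trans hg) (abs_nonneg _)
      _ = C * (|cf u m| * (coneSubmultWeight hϱ).toFun m) := by ring
  · refine Summable.of_norm_bounded ((summable_abs_cf hϱ u).mul_right 1) fun m => ?_
    rw [norm_mul, Complex.norm_real, Real.norm_eq_abs]
    exact mul_le_mul_of_nonneg_left (norm_colPathD1_le m (norm_line_le_one hc h0) hc) (abs_nonneg _)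

/-- **The second derivative of the column series at the centre:** `∂²_t G|₀ = Σ_m u_m ∂²_t w_m(z+tc)|₀`.
[cite: ArioliKoch2019, §3 Lemma 3.1] -/
theorem iteratedDeriv_two_colSeries (hϱ1 : 1 < ϱ) (u : Wiener (coneSubmultWeight hϱ1.le)) {z c : ℂ}
    (hz : ‖z‖ < 1) (hc : ‖c‖ ≤ 1) :
    iteratedDeriv 2 (colSeries hϱ1.le u z c) 0 = colSeriesD2 hϱ1.le u z c 0 := by
  have h0 : (0 : ℝ) ∈ Ioo (-(1 - ‖z‖)) (1 - ‖z‖) := by constructor <;> linarith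
  rw [iteratedDeriv_two]
  -- `deriv G = G₁` on the interval, hence near `0`
  have hder : deriv (colSeries hϱ1.le u z c) =ᶠ[𝓝 0] colSeriesD1 hϱ1.le u z c := by
    refine Filter.eventuallyEq_of_mem (isOpen_Ioo.mem_nhds h0) fun y hy => ?_
    exact (hasDerivAt_colSeries hϱ1.le u hz hc hy).deriv
  rw [hder.deriv_eq]
  exact (hasDerivAt_colSeriesD1 hϱ1 u hz hc h0).deriv

/-! ### §5. The interior identity -/

/-- Near `t = 0`, `(Δ_D⁻¹u)(z + tc)` IS the column series (the line stays in the closed disk).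
[cite: ArioliKoch2019, §2 Lemma 2.1 with §3 Prop. 3.2] -/
theorem eval_dirInv_line_eventuallyEq (hϱ : 1 ≤ ϱ) (u : Wiener (coneSubmultWeight hϱ)) {z c : ℂ}
    (hz : ‖z‖ < 1) (hc : ‖c‖ ≤ 1) :
    (fun t : ℝ => eval hϱ (dirInv hϱ u) (z + (t : ℂ) * c)) =ᶠ[𝓝 0] colSeries hϱ u z c := by
  have h0 : (0 : ℝ) ∈ Ioo (-(1 - ‖z‖)) (1 - ‖z‖) := by constructor <;> linarith
  refine Filter.eventuallyEq_of_mem (isOpen_Ioo.mem_nhds h0) fun y hy => ?_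
  rw [eval_dirInv_eq_tsum_colFun hϱ u (norm_line_le_one hc hy)]
  unfold colSeries
  exact tsum_congr fun m => by rw [colPath_eq_colFun]

/-- `∂²_t (Δ_D⁻¹u)(z + tc)|₀ = Σ_m u_m ∂²_t w_m(z+tc)|₀` for `|z| < 1`, `|c| ≤ 1`, `ϱ > 1`.
[cite: ArioliKoch2019, §3 Lemma 3.1] -/
theorem iteratedDeriv_two_eval_dirInv_line (hϱ1 : 1 < ϱ) (u : Wiener (coneSubmultWeight hϱ1.le))
    {z c : ℂ} (hz : ‖z‖ < 1) (hc : ‖c‖ ≤ 1) :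
    iteratedDeriv 2 (fun t : ℝ => eval hϱ1.le (dirInv hϱ1.le u) (z + (t : ℂ) * c)) 0
      = colSeriesD2 hϱ1.le u z c 0 := by
  have he := eval_dirInv_line_eventuallyEq hϱ1.le u hz hc
  rw [iteratedDeriv_two, (he.deriv).deriv_eq, ← iteratedDeriv_two]
  exact iteratedDeriv_two_colSeries hϱ1 u hz hc

/-- **`Δ (Δ_D⁻¹u) = u` on the open unit disk** (directional form `ConeMonomial.lapRI`), for every `u` in the
cone algebra `ℓ¹_ϱ(ζ^aζ̄^b)` with `ϱ > 1`: termwise, `Δ w_m = ζ^aζ̄^b` and the two differentiated series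
converge absolutely. [cite: ArioliKoch2019, §2 Lemma 2.1 (Δ⁻¹ inverts Δ termwise); §3 Lemma 3.1 (ρ > 1)] -/
theorem lapRI_eval_dirInv (hϱ1 : 1 < ϱ) (u : Wiener (coneSubmultWeight hϱ1.le)) {z : ℂ} (hz : ‖z‖ < 1) :
    lapRI (fun w => eval hϱ1.le (dirInv hϱ1.le u) w) z = eval hϱ1.le u z := by
  have hϱ : 1 ≤ ϱ := hϱ1.le
  unfold lapRI
  have e1 : (fun t : ℝ => eval hϱ (dirInv hϱ u) (z + (t : ℂ)))
      = fun t : ℝ => eval hϱ (dirInv hϱ u) (z + (t : ℂ) * 1) := by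
    funext t; rw [mul_one]
  rw [e1, iteratedDeriv_two_eval_dirInv_line hϱ1 u hz (by simp),
    iteratedDeriv_two_eval_dirInv_line hϱ1 u hz (by simp)]
  -- both termwise second-derivative series converge (bound `(a+b+2)|u_m|`, t = 0)
  have h0 : ‖z + ((0 : ℝ) : ℂ) * (1 : ℂ)‖ ≤ 1 := by simpa using hz.le
  have h0' : ‖z + ((0 : ℝ) : ℂ) * I‖ ≤ 1 := by simpa using hz.le
  set C : ℝ := 1 / (ϱ - 1) + 2 with hC
  have hdom : Summable fun m => C * (|cf u m| * (coneSubmultWeight hϱ).toFun m) := (mem_cf u).mul_left C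
  have hsum : ∀ c : ℂ, ‖c‖ ≤ 1 → ‖z + ((0 : ℝ) : ℂ) * c‖ ≤ 1 →
      Summable fun m => (cf u m : ℂ) * colPathD2 m z c 0 := by
    intro c hc hw
    refine Summable.of_norm_bounded hdom fun m => ?_
    rw [norm_mul, Complex.norm_real, Real.norm_eq_abs]
    have hb := norm_colPathD2_le m hw hc
    have hg : ((idx m).1 : ℝ) + (idx m).2 + 2 ≤ C * (coneSubmultWeight hϱ).toFun m := by
      rw [coneSubmultWeight_apply, idx_apply]
      have := deg_add_two_le_weight hϱ1 (m 0 + m 1)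
      push_cast at this
      simpa [hC] using this
    calc |cf u m| * ‖colPathD2 m z c 0‖ ≤ |cf u m| * (C * (coneSubmultWeight hϱ).toFun m) :=
          mul_le_mul_of_nonneg_left (hb.trans hg) (abs_nonneg _)
      _ = C * (|cf u m| * (coneSubmultWeight hϱ).toFun m) := by ring
  unfold colSeriesD2
  rw [← (hsum 1 (by simp) h0).tsum_add (hsum I (by simp) h0')]
  unfold eval
  refine tsum_congr fun m => ?_
  rw [← mul_add, colPathD2_one_add_I]

/-- **Interior equation of the certificate's zero:** if `x − Δ_D⁻¹(v x + Σ_{k≤m} c_k x^k) − g = 0` in `W`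
(`PolynomialNonlinearity.semilinMap (dirInv …) v c m g x = 0`, e.g. the zero of
`ConeSemilinear.cone_existsUnique_zero_of_semilin`), then on the open unit disk
`Δ(x − g)(z) = v(z)·x(z) + Σ_{k≤m} c_k(z)·x(z)^k` (and `x = g` on the circle, previous file).
[cite: ArioliKoch2019, eq. (1.4) (p. 4) and §4 Lemma 4.1 (pp. 9–10) (fixed points of G = (−Δ)⁻¹(w f′(·)) solve the equation)] -/
theorem lapRI_sub_eq_of_semilinMap_eq_zero (hϱ1 : 1 < ϱ) {v g x : Wiener (coneSubmultWeight hϱ1.le)}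
    {c : ℕ → Wiener (coneSubmultWeight hϱ1.le)} {m : ℕ}
    (hx : Literature.Analysis.Calculus.PolynomialNonlinearity.semilinMap (dirInv hϱ1.le) v c m g x = 0)
    {z : ℂ} (hz : ‖z‖ < 1) :
    lapRI (fun w => eval hϱ1.le (x - g) w) z
      = eval hϱ1.le v z * eval hϱ1.le x z
        + ∑ k ∈ Finset.range (m + 1), eval hϱ1.le (c k) z * (eval hϱ1.le x z) ^ k := by
  have hϱ : 1 ≤ ϱ := hϱ1.le
  have h : x - g = dirInv hϱ (v * x + Literature.Analysis.Calculus.PolynomialNonlinearity.polyMap c m x) := by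
    unfold Literature.Analysis.Calculus.PolynomialNonlinearity.semilinMap at hx
    have h1 := sub_eq_zero.1 hx
    rw [← h1, sub_sub_cancel]
  rw [h, lapRI_eval_dirInv hϱ1 _ hz, eval_add hϱ _ _ hz.le, eval_mul hϱ _ _ hz.le]
  unfold Literature.Analysis.Calculus.PolynomialNonlinearity.polyMap
  rw [eval_polyMap hϱ c m x hz.le]

end ConeEval

end Literature.Analysis.ValidatedNumerics
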